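import Mathlib
import Summits.MatrixMultiplication.Statement
import Summits.MatrixMultiplication.MatrixMultiplication.Theorems.GraphEquationsInitialForms
import Summits.MatrixMultiplication.MatrixMultiplication.Theorems.GraphEquationsBorderReadOut

/-!
# The order-free initial-form read-out in border rank (`GraphEquations`, kernel M28)

Decomp-mm node «GraphEquations» (lens 5, g36); attacked leaf `MultiplicityReduction`
(stmt-MatrixMultiplication-27806).  Target of the node, VERBATIM: `_root_.MatrixMultiplication`.
Route-neutral (`closes` unchanged); imports no `Theses/` file.

**Theorem D (degenerate read-out).**  Kernel M8 (`tensorRank_le_of_initialForms`) reads a cheap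
family whose weighted initial forms (weights `w(a) = w(b) = 1`, `w(c) = 2`) of orders `m_o ≤ K`
are pure, `P_o(f)`, with gradient matrix of rank `n²` at some `γ`, at EXACT rank `≤ 2K²N`; the
`K²` pays for the weighted truncation, and through `K ≥ m_o` it is a MULTIPLICITY charge — the
piece `H_init` (`InitialFormReduction`) accordingly asks for a BOUNDED order.  In BORDER rank the
truncation is replaced by the cost-free degeneration `a ↦ εa, b ↦ εb, c_q ↦ ε²γ_q` over `ℂ((ε))`
(`epsScale`): a weighted homogeneous component of degree `d` is multiplied by `ε^d`
(`aeval_epsScale_of_isWeightedHomogeneous`), so if `m_o` is the LOWEST weighted order of the test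
`t_o` then `ε^{-m_o}·t_o(εa, εb, ε²γ)` has `a ⊗ b`-block `-Σ_q (∂P_o/∂F_q)(γ)·(ab)_q + O(ε)`
(`isOrdGE_block_lowestForm`, from M8's `coeff_ab_aeval_psi`), and a left inverse of the gradient
matrix serves `⟨n,n,n⟩` up to `O(ε)`:

* `algBorderRank_le_of_lowestForms` — `bR(⟨n,n,n⟩) ≤ 2N`, for initial forms of ANY orders;
* `EqSystem.LowInitNondegAt` / `algBorderRank_le_of_lowInitNondegAt` — the system form after the
  free shift to a point `x` (`bR ≤ 2·cost`);
* the order-free piece **`H_init^♭`** = `LowestFormReduction` («cheap correct systems can be made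
  cheap with pure nondegenerate LOWEST-order forms at some point — orders unbounded») with
  `omega_le_of_eqAdmissibleLowInit` (Bini) and
  `multiplicityReduction_of_lowestFormReduction : H_init^♭ → H_mult` (so `V ∧ H_init^♭ → ω = 2`).

So multiplicity — the order of the initial forms — is free in border currency; what `H_init^♭`
still asks for is PURITY and NONDEGENERACY of the lowest-order forms (M9a's `Purification`
without its order bound): the residual obstruction behind `MultiplicityReduction` is masking, not
multiplicity (NODE-g36 §4).  No `sorry`.

Sources: [BurgisserClausenShokrollahi1997, §4.1 Rem. (4.3), Prop. (14.1), §15.4 (Bini),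
Problem 16.3]; T. Lickteig's `ε`-weight argument for `C(SL_n) ≍ bR(⟨n,n,n⟩)` (BCS (16.19));
[Andrews2024] (border form of `R ≤ 2L`).
-/

set_option linter.dupNamespace false

noncomputable section

open scoped BigOperators

namespace Summit.MatrixMultiplication.MatrixMultiplication.Theorems.GraphEquations

open MvPolynomial
open Literature.Computability.AlgebraicComplexity

variable {n : ℕ}

/-! ## The weighted degeneration `v ↦ ε^{w(v)} θ_γ(v)` -/

/-- `ε^k` is the monomial `single k 1`. -/
theorem bEps_pow (k : ℕ) : bEps ^ k = HahnSeries.single (k : ℤ) (1 : ℂ) := by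
  induction k with
  | zero => simp
  | succ k ih =>
    rw [pow_succ, ih, bEps, HahnSeries.single_mul_single, mul_one]
    push_cast
    rfl

/-- `ε^{-m} ε^d = ε^{d-m}` for `m ≤ d`. -/
theorem bEpsInv_pow_mul_bEps_pow_of_le {m d : ℕ} (h : m ≤ d) :
    bEpsInv ^ m * bEps ^ d = bEps ^ (d - m) := by
  obtain ⟨e, rfl⟩ := Nat.exists_eq_add_of_le h
  rw [pow_add, ← mul_assoc, bEpsInv_pow_mul_bEps_pow, one_mul, Nat.add_sub_cancel_left]

/-- The weighted degeneration: `a ↦ εa`, `b ↦ εb`, `c_q ↦ ε² γ_q`. -/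
def epsScale (γ : Fin n × Fin n → ℂ) (v : GraphVars n) :
    MvPolynomial (GraphVars n) (LaurentSeries ℂ) :=
  C (bEps ^ gw n v) * map (algebraMap ℂ (LaurentSeries ℂ)) (constC γ v)

/-- The degeneration is affine-linear, hence cost-free. -/
theorem epsScale_mem_freeSpan (γ : Fin n × Fin n → ℂ)
    (S : Set (MvPolynomial (GraphVars n) (LaurentSeries ℂ))) (v : GraphVars n) :
    epsScale γ v ∈ freeSpan S := by
  rcases v with v | q
  · simp only [epsScale, constC, map_X]
    rw [← smul_eq_C_mul]
    exact Submodule.smul_mem _ _ (X_mem_freeSpan S _)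
  · simp only [epsScale, constC, map_C, ← C_mul]
    exact C_mem_freeSpan S _

/-- **Weighted homogeneous components scale by `ε^d`.** -/
theorem aeval_epsScale_of_isWeightedHomogeneous (γ : Fin n × Fin n → ℂ)
    {p : MvPolynomial (GraphVars n) ℂ} {d : ℕ} (hp : IsWeightedHomogeneous (gw n) p d) :
    aeval (epsScale γ) (map (algebraMap ℂ (LaurentSeries ℂ)) p) =
      C (bEps ^ d) * map (algebraMap ℂ (LaurentSeries ℂ)) (aeval (constC γ) p) := by
  classical
  conv_lhs => rw [p.as_sum]
  conv_rhs => rw [p.as_sum]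
  simp only [map_sum, Finset.mul_sum]
  refine Finset.sum_congr rfl fun μ hμ => ?_
  have hw : Finsupp.weight (gw n) μ = d := hp (mem_support_iff.1 hμ)
  rw [map_monomial, aeval_monomial, aeval_monomial, map_mul]
  have hC : (∏ v ∈ μ.support, C (σ := GraphVars n) bEps ^ (gw n v * μ v)) = C bEps ^ d := by
    rw [Finset.prod_pow_eq_pow_sum, ← hw, Finsupp.weight_apply, Finsupp.sum]
    exact congrArg _ (Finset.sum_congr rfl fun v _ => by rw [smul_eq_mul, mul_comm])
  simp only [Finsupp.prod, map_prod, map_pow, MvPolynomial.algebraMap_eq, map_C, epsScale, mul_pow,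
    Finset.prod_mul_distrib, ← pow_mul]
  rw [hC]
  ring

/-- A polynomial is the sum of its weighted components over the weights of its support. -/
theorem eq_sum_weightedHomogeneousComponent (p : MvPolynomial (GraphVars n) ℂ) {S : Finset ℕ}
    (hS : ∀ μ ∈ p.support, Finsupp.weight (gw n) μ ∈ S) :
    p = ∑ d ∈ S, weightedHomogeneousComponent (gw n) d p := by
  classical
  conv_lhs => rw [← sum_weightedHomogeneousComponent (gw n) p]
  refine finsum_eq_sum_of_support_subset _ fun d hd => ?_
  rw [Function.mem_support] at hd
  by_contra hdS
  refine hd (weightedHomogeneousComponent_eq_zero' d p fun μ hμ h => hdS ?_)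
  rw [Finset.mem_coe]
  exact h ▸ hS μ hμ

/-! ## The block of the lowest form -/

/-- **The `a ⊗ b`-block of `ε^{-m} t(εa, εb, ε²γ)`** when `m` is the lowest weighted order of `t`
and the weighted component of order `m` is pure, `P(f)`: it is `-[j = j'] (∂P/∂F_{il})(γ) + O(ε)`. -/
theorem isOrdGE_block_lowestForm (γ : Fin n × Fin n → ℂ) {p : MvPolynomial (GraphVars n) ℂ}
    {m : ℕ} (hlow : ∀ μ ∈ p.support, m ≤ Finsupp.weight (gw n) μ)
    {P : MvPolynomial (Fin n × Fin n) ℂ}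
    (hinit : weightedHomogeneousComponent (gw n) m p = aeval (generator n) P) (i j j' l : Fin n) :
    IsOrdGE 1 (bEpsInv ^ m *
        coeff (abMono n i j j' l) (aeval (epsScale γ) (map (algebraMap ℂ (LaurentSeries ℂ)) p)) -
      HahnSeries.C (-(if j = j' then eval γ (pderiv (i, l) P) else 0))) := by
  classical
  set S : Finset ℕ := insert m (p.support.image (Finsupp.weight (gw n))) with hS
  have hmem : ∀ μ ∈ p.support, Finsupp.weight (gw n) μ ∈ S := fun μ hμ =>
    Finset.mem_insert_of_mem (Finset.mem_image_of_mem _ hμ)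
  have hmS : m ∈ S := Finset.mem_insert_self _ _
  -- expand `p` into weighted components and scale each by `ε^d`
  have hexp : aeval (epsScale γ) (map (algebraMap ℂ (LaurentSeries ℂ)) p) =
      ∑ d ∈ S, C (bEps ^ d) * map (algebraMap ℂ (LaurentSeries ℂ))
        (aeval (constC γ) (weightedHomogeneousComponent (gw n) d p)) := by
    conv_lhs => rw [eq_sum_weightedHomogeneousComponent p hmem]
    simp only [map_sum]
    exact Finset.sum_congr rfl fun d _ =>
      aeval_epsScale_of_isWeightedHomogeneous γ
        (weightedHomogeneousComponent_isWeightedHomogeneous d p)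
  -- the coefficient of each scaled component
  set c : ℕ → ℂ := fun d =>
    coeff (abMono n i j j' l) (aeval (constC γ) (weightedHomogeneousComponent (gw n) d p)) with hc
  have hcoef : coeff (abMono n i j j' l) (aeval (epsScale γ) (map (algebraMap ℂ (LaurentSeries ℂ)) p))
      = ∑ d ∈ S, bEps ^ d * HahnSeries.C (c d) := by
    -- constants of `ℂ((ε))`: `algebraMap ℂ ℂ((ε)) = HahnSeries.C` (as in `ModularFunctionField`)
    have hι : ∀ x : ℂ, algebraMap ℂ (LaurentSeries ℂ) x = HahnSeries.C x := fun x => by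
      rw [HahnSeries.algebraMap_apply']; simp
    rw [hexp, coeff_sum]
    exact Finset.sum_congr rfl fun d _ => by rw [coeff_C_mul, coeff_map, hι]
  -- the lowest one is the pure form: M8's coefficient identity
  have hcm : c m = -(if j = j' then eval γ (pderiv (i, l) P) else 0) := by
    simp only [hc, hinit, aeval_constC_aeval_generator]
    exact coeff_ab_aeval_psi γ P i j j' l
  rw [hcoef, Finset.mul_sum, ← Finset.add_sum_erase S _ hmS, ← mul_assoc,
    bEpsInv_pow_mul_bEps_pow, one_mul, hcm, add_sub_cancel_left]
  refine IsOrdGE.sum fun d hd => ?_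
  have hdm : m < d := by
    obtain ⟨hne, hd'⟩ := Finset.mem_erase.1 hd
    rcases Finset.mem_insert.1 hd' with h | h
    · exact (hne h).elim
    · obtain ⟨μ, hμ, rfl⟩ := Finset.mem_image.1 h
      exact lt_of_le_of_ne (hlow μ hμ) (Ne.symm hne)
  rw [← mul_assoc, bEpsInv_pow_mul_bEps_pow_of_le hdm.le, bEps_pow]
  have h1 : (1 : ℤ) ≤ ((d - m : ℕ) : ℤ) := by omega
  simpa using ((IsOrdGE.single (((d - m : ℕ) : ℤ)) (1 : ℂ)).mono h1).mul (IsOrdGE.C (c d))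

/-! ## Theorem D -/

/-- **THEOREM D — THE ORDER-FREE INITIAL-FORM READ-OUT (border rank).**  Let `T` polynomials lie
in the cost-free span of one nonscalar sequence of length `≤ N`; let `m_o` be (a lower bound for)
the lowest weighted order of `t_o` and let the weighted component of order `m_o` be pure, `P_o(f)`,
with gradient matrix `(∂P_o/∂F_q)(γ)` of rank `n²` at some `γ`.  Then `bR(⟨n,n,n⟩) ≤ 2N` — with no
dependence on the orders `m_o` (M8, exact rank: `2K²N` for `m_o ≤ K`). -/
theorem algBorderRank_le_of_lowestForms {T N : ℕ} (p : Fin T → MvPolynomial (GraphVars n) ℂ)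
    (hspan : ∃ gs : List (MvPolynomial (GraphVars n) ℂ), IsNonscalarSeq gs ∧ gs.length ≤ N ∧
      ∀ o, p o ∈ freeSpan {q | q ∈ gs})
    (m : Fin T → ℕ) (hlow : ∀ o, ∀ μ ∈ (p o).support, m o ≤ Finsupp.weight (gw n) μ)
    (P : Fin T → MvPolynomial (Fin n × Fin n) ℂ)
    (hinit : ∀ o, weightedHomogeneousComponent (gw n) (m o) (p o) = aeval (generator n) (P o))
    (γ : Fin n × Fin n → ℂ) (hrank : (gradMatrix γ P).rank = n * n) :
    algBorderRank (matMulTensor ℂ n n n) ≤ 2 * N := by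
  classical
  -- transport along the degeneration (free)
  obtain ⟨gs, hns, hlen, hmem⟩ :=
    exists_free_aeval_map p hspan (epsScale γ) (epsScale_mem_freeSpan γ _)
  -- a left inverse of the gradient matrix
  obtain ⟨Pm, hPJ⟩ := leftInverse_of_rank_eq (gradMatrix γ P) hrank
  have hPJ' : ∀ c q, ∑ o, Pm c o * gradMatrix γ P o q = if c = q then 1 else 0 := by
    intro c q
    have := congrFun (congrFun hPJ c) q
    simpa [Matrix.mul_apply, Matrix.one_apply] using this
  refine algBorderRank_le_of_abBorderServed
    (fun c => ∑ o, C ((HahnSeries.C (-Pm c o) : LaurentSeries ℂ) * bEpsInv ^ m o) *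
      aeval (epsScale γ) (map (algebraMap ℂ (LaurentSeries ℂ)) (p o)))
    ⟨gs, hns, hlen, fun c => Submodule.sum_mem _ fun o _ => ?_⟩ fun c i j j' l => ?_
  · rw [← smul_eq_C_mul]
    exact Submodule.smul_mem _ _ (hmem o)
  · -- the block: `Σ_o -Pm_{co} (ε^{-m_o} coeff_o)` with `ε^{-m_o} coeff_o = -[j=j'] G_{o,(i,l)} + O(ε)`
    have hblock := fun o => isOrdGE_block_lowestForm γ (hlow o) (hinit o) i j j' l
    have hsum : (∑ o, -Pm c o * -(if j = j' then eval γ (pderiv (i, l) (P o)) else 0)) =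
        if j = j' then (if c = (i, l) then 1 else 0) else 0 := by
      by_cases hjj : j = j'
      · subst hjj
        simp only [neg_mul_neg, if_true]
        rw [← hPJ' c (i, l)]
        rfl
      · simp [hjj]
    have htarget : (HahnSeries.C (matMulTensor ℂ n n n c (i, j) (j', l)) : LaurentSeries ℂ) =
        ∑ o, (HahnSeries.C (-Pm c o) : LaurentSeries ℂ) *
          HahnSeries.C (-(if j = j' then eval γ (pderiv (i, l) (P o)) else 0)) := by
      rw [matMulTensor_eq_ite, ← hsum, map_sum]
      exact Finset.sum_congr rfl fun o _ => map_mul _ _ _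
    rw [coeff_sum, htarget, ← Finset.sum_sub_distrib]
    refine IsOrdGE.sum fun o _ => ?_
    rw [coeff_C_mul, mul_assoc, ← mul_sub]
    have h := (IsOrdGE.C (-Pm c o)).mul (hblock o)
    rwa [zero_add] at h

namespace EqSystem

/-- **LOWEST-FORM NONDEGENERATE at `x`** (no order bound).  After the free shift `θ_x`, each test
has a pure weighted component `P_o(f)` at (a lower bound `m_o` of) its lowest weighted order, and
the gradient matrix of `P` has rank `n²` at some `γ`.  (`InitNondegAt K x` with `m_o` minimal is
the case of bounded orders; `ReducedAt x` the case `m_o = 2`, `P_o` linear.) -/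
def LowInitNondegAt (E : EqSystem n) (x : GraphVars n → ℂ) : Prop :=
  ∃ (m : Fin E.tests.length → ℕ) (P : Fin E.tests.length → MvPolynomial (Fin n × Fin n) ℂ)
    (γ : Fin n × Fin n → ℂ),
    (∀ o, ∀ μ ∈ (bind₁ (shift x) (E.testPoly (E.tests.get o))).support,
      m o ≤ Finsupp.weight (gw n) μ) ∧
    (∀ o, weightedHomogeneousComponent (gw n) (m o)
        (bind₁ (shift x) (E.testPoly (E.tests.get o))) = aeval (generator n) (P o)) ∧
    (gradMatrix γ P).rank = n * n

/-- Lowest-form nondegenerate at SOME point. -/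
def LowInitNondeg (E : EqSystem n) : Prop := ∃ x : GraphVars n → ℂ, E.LowInitNondegAt x

end EqSystem

/-- **Border cost–rank inequality for lowest-form nondegenerate systems**: `bR(⟨n,n,n⟩) ≤ 2·cost`,
whatever the orders of the initial forms. -/
theorem algBorderRank_le_of_lowInitNondegAt {E : EqSystem n} (hE : E.circuit.IsFanInTwo)
    {x : GraphVars n → ℂ} (h : E.LowInitNondegAt x) :
    algBorderRank (matMulTensor ℂ n n n) ≤ 2 * E.cost := by
  obtain ⟨m, P, γ, hlow, hinit, hrank⟩ := h
  obtain ⟨gs, hns, hlen, hmem⟩ := exists_isNonscalarSeq_tests E hE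
  obtain ⟨hns', hmem'⟩ :=
    IsNonscalarSeq.aeval_append (θ := shift x) (hs := []) (shift_mem_freeSpan x)
      isNonscalarSeq_nil hns
  refine algBorderRank_le_of_lowestForms
    (fun o => bind₁ (shift x) (E.testPoly (E.tests.get o)))
    ⟨gs.map (aeval (shift x)) ++ [], hns', by simpa using hlen, fun o => ?_⟩ m hlow P hinit γ hrank
  rw [← aeval_eq_bind₁]
  exact hmem' _ (hmem o)

/-! ## The order-free piece `H_init^♭` -/

/-- `EqAdmissibleLowInit β`: correct systems of cost `O(n^β)`, lowest-form nondegenerate at some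
point (orders UNBOUNDED), exist for all `n ≥ 1`. -/
def EqAdmissibleLowInit (β : ℝ) : Prop :=
  ∃ c : ℝ, ∀ n : ℕ, 1 ≤ n → ∃ E : EqSystem n, E.Correct ∧ E.LowInitNondeg ∧
    (E.cost : ℝ) ≤ c * (n : ℝ) ^ β

/-- **`EqAdmissibleLowInit β → ω ≤ β`** (border families of cost `2·c·n^β`, Bini). -/
theorem omega_le_of_eqAdmissibleLowInit {β : ℝ} (h : EqAdmissibleLowInit β) : omega ℂ ≤ β := by
  obtain ⟨c, hc⟩ := h
  refine omega_le_of_algBorderRank_bound (c := 2 * c) fun n hn => ?_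
  obtain ⟨E, hE, ⟨x, hx⟩, hcost⟩ := hc n hn
  have h1 : (algBorderRank (matMulTensor ℂ n n n) : ℝ) ≤ 2 * (E.cost : ℝ) := by
    exact_mod_cast algBorderRank_le_of_lowInitNondegAt hE.1 hx
  nlinarith [h1, hcost]

/-- **`H_init^♭` — LOWEST-FORM REDUCTION (order-free).**  A correct system of cost `O(n^β)` can be
replaced, for every `β' > β`, by a correct system of cost `O(n^{β'})` which is lowest-form
nondegenerate at some point — with NO bound on the orders (the multiplicity). -/
def LowestFormReduction : Prop :=
  ∀ β : ℝ, 2 ≤ β → EqAdmissible β → ∀ β' : ℝ, β < β' → EqAdmissibleLowInit β'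

/-- **`H_init^♭ → H_mult`.** -/
theorem multiplicityReduction_of_lowestFormReduction (h : LowestFormReduction) :
    MultiplicityReduction := by
  intro β hβ hE β' hβ'
  obtain ⟨β₁, h₁, h₂⟩ := exists_between hβ'
  exact eqAdmissibleRed_of_omega_lt (lt_of_le_of_lt (omega_le_of_eqAdmissibleLowInit (h β hβ hE β₁ h₁)) h₂)

/-- Hence `V ∧ H_init^♭ → ω = 2`. -/
theorem matrixMultiplication_of_quadratic_of_lowestFormReduction (hV : GraphEquationsQuadratic)
    (h : LowestFormReduction) : _root_.MatrixMultiplication :=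
  matrixMultiplication_of_quadratic_of_multiplicityReduction hV
    (multiplicityReduction_of_lowestFormReduction h)

end Summit.MatrixMultiplication.MatrixMultiplication.Theorems.GraphEquations
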